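/-
Copyright (c) 2026. All rights reserved.
Released under Apache 2.0 license as described in the file LICENSE.
Authors: abc-iut cell — seat abc-iut-w4-d104 (wave 4, D-0067; node AbsTopIII:Prop2.6, bridge between
the germ-group model and the `(U, 𝒬(U))`-algorithm of Prop 2.5 (e)). Proof-only; no new definitions.
-/
import Literature.AnabelianGeometry.AbsoluteAnabelian.HolomorphicCoresLocalLinearProofs
import Literature.AnabelianGeometry.AbsoluteAnabelian.ParallelogramsLocalAddExists
import HarnessLib

/-!
# [AbsTopIII] Prop 2.6 over Prop 2.5 (e): "compatible with the local additive structures"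

This file connects the condition `LocGerm.IsLocallyAdditiveAt p f r` used by the germ-group model
`germAut p` of [AbsTopIII] Prop. 2.6 (`HolomorphicCoresLocalLinearProofs.lean`) with the ABSTRACT
local additive structure `Parallelograms.LocalAdd 𝒬 p a b c` of Prop. 2.5 (e) reconstructed from the
input data `(U, 𝒬(U))` (`HolomorphicCores.lean`), granted the Prop. 2.5 (c) reconstruction
`Parallelograms.parallelograms 𝒬 = {P | val '' P ∈ 𝒫(U)}` (first clause of `TwoOrientations`):

* `Parallelograms.localAdd_map_affine` — an affine map `z ↦ p + L (z − p)` with `L` injective carries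
  the relation `a +_p b = c` to `a' +_p b' = c'` for `a, b` near `p` (images in `U`): affine germs ARE
  "compatible with the local additive structures";
* `LocGerm.isLocallyAdditiveAt_of_localAdd_compat` — conversely, a self-map `f` of `ℂ` fixing `p`,
  continuous on a ball around `p` inside `U`, which carries `a +_p b = c` to `f a +_p f b = f c`
  whenever the images lie in `U`, is additive near `p` relative to the origin `p` on some ball, i.e.
  satisfies `LocGerm.IsLocallyAdditiveAt p f r'` (general position by Prop. 2.5 (e) directly; the
  collinear pairs, where `a +_p b` is undefined, by continuity — the density of general position).

So for germs of local homeomorphisms at `p` the first defining condition of `𝒜_p` (`germAut p`) is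
exactly the printed one.  S. Mochizuki, *Topics in absolute anabelian geometry III*, Prop. 2.5 (e)
p. 57 and Prop. 2.6 (a) p. 57 (bib key `MochizukiAbsTopIII2015`).  Refereed pre-IUT material;
nothing here bears on the disputed [IUTchIII] Cor. 3.12.
-/

namespace Literature.AnabelianGeometry.AbsoluteAnabelian

open _root_.Complex _root_.Set _root_.Topology _root_.Filter

noncomputable section

section Compat

variable {U : Set ℂ}

/-- An injective `ℝ`-linear map preserves independence of a pair. (Auxiliary.)
[cite: MochizukiAbsTopIII2015, Proposition 2.6 (proof) pp.57–58] -/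
theorem linearIndependent_pair_map {L : ℂ →L[ℝ] ℂ} (hL : Function.Injective L) {x y : ℂ}
    (h : LinearIndependent ℝ ![x, y]) : LinearIndependent ℝ ![L x, L y] := by
  rw [LinearIndependent.pair_iff] at h ⊢
  intro s t hst
  refine h s t (hL ?_)
  rw [map_add, map_smul, map_smul, map_zero]
  exact hst

/-- **Affine germs are compatible with the local additive structures.** For `U ⊆ ℂ` open,
`𝒮(U) ⊆ 𝒬 ⊆ 𝒫(U)`, granted the Prop 2.5 (c) reconstruction, `p ∈ U` and `L` an injective continuous
`ℝ`-linear map: there is `δ > 0` such that for `a, b` within `δ` of `p`, `a +_p b = c` implies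
`a' +_p b' = c'` for the images `z' = p + L (z − p)` (whenever these lie in `U`).
[cite: MochizukiAbsTopIII2015, Proposition 2.6 (a) p.57] -/
theorem Parallelograms.localAdd_map_affine (hU : IsOpen U) {𝒬 : Set (Set U)}
    (h𝒬 : ∀ Q ∈ 𝒬, Subtype.val '' Q ∈ parallelogramsIn U)
    (h𝒮 : ∀ Q : Set U, Subtype.val '' Q ∈ squaresIn U → Q ∈ 𝒬)
    (H : Parallelograms.parallelograms 𝒬 = {P : Set U | Subtype.val '' P ∈ parallelogramsIn U})
    (p : U) {L : ℂ →L[ℝ] ℂ} (hL : Function.Injective L) :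
    ∃ δ > 0, ∀ a b c : U, ‖(a : ℂ) - p‖ < δ → ‖(b : ℂ) - p‖ < δ →
      Parallelograms.LocalAdd 𝒬 p a b c →
      ∀ (ha' : (p : ℂ) + L (a - p) ∈ U) (hb' : (p : ℂ) + L (b - p) ∈ U)
        (hc' : (p : ℂ) + L (c - p) ∈ U),
        Parallelograms.LocalAdd 𝒬 p ⟨_, ha'⟩ ⟨_, hb'⟩ ⟨_, hc'⟩ := by
  obtain ⟨ε, hε, hiff⟩ := Parallelograms.exists_nhds_localAdd_iff hU h𝒬 h𝒮 H p
  refine ⟨ε / (‖L‖ + 1), by positivity, fun a b c ha hb h ha' hb' hc' => ?_⟩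
  have hsmall : ∀ {z : ℂ}, ‖z - p‖ < ε / (‖L‖ + 1) → ‖(p : ℂ) + L (z - p) - p‖ < ε := by
    intro z hz
    rw [add_sub_cancel_left]
    calc ‖L (z - p)‖ ≤ ‖L‖ * ‖z - (p : ℂ)‖ := L.le_opNorm _
      _ ≤ (‖L‖ + 1) * ‖z - (p : ℂ)‖ := by gcongr; linarith
      _ < (‖L‖ + 1) * (ε / (‖L‖ + 1)) := by gcongr
      _ = ε := by field_simp
  by_cases hap : a = p
  · subst hap
    rw [Parallelograms.localAdd_pt_left_iff] at h
    subst h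
    have : (⟨(a : ℂ) + L (a - a), ha'⟩ : U) = a := Subtype.ext (by simp)
    rw [this, Parallelograms.localAdd_pt_left_iff]
  by_cases hbp : b = p
  · subst hbp
    rw [Parallelograms.localAdd_pt_right_iff] at h
    subst h
    have : (⟨(b : ℂ) + L (b - b), hb'⟩ : U) = b := Subtype.ext (by simp)
    rw [this, Parallelograms.localAdd_pt_right_iff]
  obtain ⟨hc, hind⟩ := Parallelograms.coe_eq_of_localAdd hU h𝒬 h𝒮 H hap hbp h
  have hap' : (⟨(p : ℂ) + L (a - p), ha'⟩ : U) ≠ p := by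
    intro h0
    have h1 : L ((a : ℂ) - p) = 0 := by
      have := congrArg Subtype.val h0
      simpa using this
    exact hap (Subtype.ext (sub_eq_zero.1 (hL (by rw [h1, map_zero]))))
  have hbp' : (⟨(p : ℂ) + L (b - p), hb'⟩ : U) ≠ p := by
    intro h0
    have h1 : L ((b : ℂ) - p) = 0 := by
      have := congrArg Subtype.val h0
      simpa using this
    exact hbp (Subtype.ext (sub_eq_zero.1 (hL (by rw [h1, map_zero]))))
  refine (hiff _ _ _ (hsmall ha) (hsmall hb) hap' hbp').2 ⟨?_, ?_⟩
  · simp only [add_sub_cancel_left]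
    exact linearIndependent_pair_map hL hind
  · show (p : ℂ) + L (c - p) = ((p : ℂ) + L (a - p)) + ((p : ℂ) + L (b - p)) - p
    rw [hc, show (a : ℂ) + b - p - p = ((a : ℂ) - p) + ((b : ℂ) - p) by ring, map_add]
    ring

/-- In the plane, `y + t·i x` is in general position with `x ≠ 0` for every `t ≠ 0` when `y` is not
(the perturbation used to reach collinear pairs by continuity). (Auxiliary.)
[cite: MochizukiAbsTopIII2015, Proposition 2.6 (proof) pp.57–58] -/
theorem linearIndependent_pair_perturb {x y : ℂ} (hx : x ≠ 0) (hxy : ¬ LinearIndependent ℝ ![x, y])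
    {t : ℝ} (ht : t ≠ 0) : LinearIndependent ℝ ![x, y + (t : ℂ) * (I * x)] := by
  rw [linearIndependent_pair_iff_det] at hxy ⊢
  replace hxy : x.re * y.im - x.im * y.re = 0 := not_ne_iff.1 hxy
  have hx' : x.re * x.re + x.im * x.im ≠ 0 := by
    intro h0
    have hre : x.re = 0 := by nlinarith [sq_nonneg x.re, sq_nonneg x.im]
    have him : x.im = 0 := by nlinarith [sq_nonneg x.re, sq_nonneg x.im]
    exact hx (Complex.ext (by simp [hre]) (by simp [him]))
  simp only [add_re, add_im, mul_re, mul_im, I_re, I_im, ofReal_re, ofReal_im, zero_mul, one_mul,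
    zero_sub, sub_zero, zero_add]
  intro h0
  have : t * (x.re * x.re + x.im * x.im) = 0 := by linear_combination h0 - hxy
  rcases mul_eq_zero.1 this with h1 | h1
  · exact ht h1
  · exact hx' h1

/-- **A local homeomorphism compatible with `+_p` is locally additive.** For `U ⊆ ℂ` open,
`𝒮(U) ⊆ 𝒬 ⊆ 𝒫(U)`, granted the Prop 2.5 (c) reconstruction, and `p ∈ U`: if `f : ℂ → ℂ` fixes `p`, is
continuous on a ball `B(p, r) ⊆ U`, and carries the Prop 2.5 (e) relation `a +_p b = c` (for
`a, b, c ∈ B(p, r)`) to `f a +_p f b = f c` whenever `f a, f b, f c ∈ U`, then `f` is additive near `p`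
relative to the origin `p`: `LocGerm.IsLocallyAdditiveAt p f r'` for some `r' > 0` — the first
condition defining `𝒜_p = germAut p`.  (General-position pairs: Prop 2.5 (e) read both ways,
`Parallelograms.exists_nhds_localAdd_iff`; collinear pairs, where `+_p` is undefined: by continuity.)
[cite: MochizukiAbsTopIII2015, Proposition 2.6 (a) p.57] -/
theorem LocGerm.isLocallyAdditiveAt_of_localAdd_compat (hU : IsOpen U) {𝒬 : Set (Set U)}
    (h𝒬 : ∀ Q ∈ 𝒬, Subtype.val '' Q ∈ parallelogramsIn U)
    (h𝒮 : ∀ Q : Set U, Subtype.val '' Q ∈ squaresIn U → Q ∈ 𝒬)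
    (H : Parallelograms.parallelograms 𝒬 = {P : Set U | Subtype.val '' P ∈ parallelogramsIn U})
    (p : U) {f : ℂ → ℂ} (hfp : f p = p) {r : ℝ} (hr : 0 < r)
    (hball : Metric.ball (p : ℂ) r ⊆ U) (hfc : ContinuousOn f (Metric.ball (p : ℂ) r))
    (hcompat : ∀ a b c : U, ‖(a : ℂ) - p‖ < r → ‖(b : ℂ) - p‖ < r → ‖(c : ℂ) - p‖ < r →
      Parallelograms.LocalAdd 𝒬 p a b c →
      ∀ (ha' : f a ∈ U) (hb' : f b ∈ U) (hc' : f c ∈ U),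
        Parallelograms.LocalAdd 𝒬 p ⟨f a, ha'⟩ ⟨f b, hb'⟩ ⟨f c, hc'⟩) :
    ∃ r' > 0, LocGerm.IsLocallyAdditiveAt (p : ℂ) f r' := by
  obtain ⟨ε, hε, hiff⟩ := Parallelograms.exists_nhds_localAdd_iff hU h𝒬 h𝒮 H p
  -- continuity of `f` at `p`: images of a small ball are `ε`-close to `p` and inside `B(p, r)`
  have hfcp : ContinuousAt f p :=
    hfc.continuousAt (Metric.isOpen_ball.mem_nhds (Metric.mem_ball_self hr))
  obtain ⟨δ, hδ, hδf⟩ := (Metric.continuousAt_iff.1 hfcp) (min ε r) (lt_min hε hr)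
  set r' : ℝ := min (min r ε) δ with hr'
  have hr'pos : 0 < r' := lt_min (lt_min hr hε) hδ
  have hr_of : ∀ {z : ℂ}, ‖z - p‖ < r' → ‖z - p‖ < r := fun hz =>
    lt_of_lt_of_le hz ((min_le_left _ _).trans (min_le_left _ _))
  have hε_of : ∀ {z : ℂ}, ‖z - p‖ < r' → ‖z - p‖ < ε := fun hz =>
    lt_of_lt_of_le hz ((min_le_left _ _).trans (min_le_right _ _))
  have hδ_of : ∀ {z : ℂ}, ‖z - p‖ < r' → ‖z - p‖ < δ := fun hz =>
    lt_of_lt_of_le hz (min_le_right _ _)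
  have hballr : ∀ {z : ℂ}, ‖z - p‖ < r → z ∈ Metric.ball (p : ℂ) r := fun hz => by
    rwa [Metric.mem_ball, dist_eq_norm]
  have hmemU : ∀ {z : ℂ}, ‖z - p‖ < r' → z ∈ U := fun hz => hball (hballr (hr_of hz))
  have hfnear : ∀ {z : ℂ}, ‖z - p‖ < r' → ‖f z - p‖ < ε ∧ ‖f z - p‖ < r := by
    intro z hz
    have h1 : dist (f z) (f p) < min ε r := hδf (by rw [dist_eq_norm]; exact hδ_of hz)
    rw [hfp, dist_eq_norm] at h1
    exact ⟨lt_of_lt_of_le h1 (min_le_left _ _), lt_of_lt_of_le h1 (min_le_right _ _)⟩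
  have hfmemU : ∀ {z : ℂ}, ‖z - p‖ < r' → f z ∈ U := fun hz => hball (hballr (hfnear hz).2)
  -- general position: Prop 2.5 (e) read on both sides
  have hgen : ∀ a b : ℂ, ‖a - p‖ < r' → ‖b - p‖ < r' → ‖a + b - p - p‖ < r' →
      LinearIndependent ℝ ![a - p, b - p] → f (a + b - p) - p = (f a - p) + (f b - p) := by
    intro a b ha hb hab hind
    have hap : a ≠ p := by
      rintro rfl
      have := (LinearIndependent.pair_iff.1 hind) 1 0 (by simp)
      simp at this
    have hbp : b ≠ p := by
      rintro rfl
      have := (LinearIndependent.pair_iff.1 hind) 0 1 (by simp)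
      simp at this
    have hapU : (⟨a, hmemU ha⟩ : U) ≠ p := fun h => hap (congrArg Subtype.val h)
    have hbpU : (⟨b, hmemU hb⟩ : U) ≠ p := fun h => hbp (congrArg Subtype.val h)
    have hadd : Parallelograms.LocalAdd 𝒬 p ⟨a, hmemU ha⟩ ⟨b, hmemU hb⟩ ⟨a + b - p, hmemU hab⟩ :=
      (hiff _ _ _ (hε_of ha) (hε_of hb) hapU hbpU).2 ⟨hind, rfl⟩
    have hadd' := hcompat _ _ _ (hr_of ha) (hr_of hb) (hr_of hab) hadd (hfmemU ha) (hfmemU hb)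
      (hfmemU hab)
    by_cases hfa : f a = p
    · have h0 : (⟨f a, hfmemU ha⟩ : U) = p := Subtype.ext hfa
      rw [h0, Parallelograms.localAdd_pt_left_iff] at hadd'
      have h2 : f (a + b - p) = f b := congrArg Subtype.val hadd'
      rw [h2, hfa]
      ring
    by_cases hfb : f b = p
    · have h0 : (⟨f b, hfmemU hb⟩ : U) = p := Subtype.ext hfb
      rw [h0, Parallelograms.localAdd_pt_right_iff] at hadd'
      have h2 : f (a + b - p) = f a := congrArg Subtype.val hadd'
      rw [h2, hfb]
      ring
    have hfaU : (⟨f a, hfmemU ha⟩ : U) ≠ p := fun h => hfa (congrArg Subtype.val h)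
    have hfbU : (⟨f b, hfmemU hb⟩ : U) ≠ p := fun h => hfb (congrArg Subtype.val h)
    obtain ⟨-, hsum⟩ := (hiff _ _ _ (hfnear ha).1 (hfnear hb).1 hfaU hfbU).1 hadd'
    have hsum' : f (a + b - p) = f a + f b - p := hsum
    rw [hsum']
    ring
  -- all pairs: degenerate ones directly, collinear ones by continuity
  refine ⟨r', hr'pos, fun a b ha hb hab => ?_⟩
  by_cases hap : a = p
  · rw [hap, show (p : ℂ) + b - p = b by ring, hfp]
    ring
  by_cases hbp : b = p
  · rw [hbp, show a + (p : ℂ) - p = a by ring, hfp]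
    ring
  by_cases hind : LinearIndependent ℝ ![a - p, b - p]
  · exact hgen a b ha hb hab hind
  -- collinear pair: perturb `b` along `i (a - p)`
  set x : ℂ := a - p with hx
  have hx0 : x ≠ 0 := sub_ne_zero.2 hap
  set u : ℂ := I * x with hu
  have h_in : Tendsto (fun t : ℝ => b + (t : ℂ) * u) (𝓝 0) (𝓝 b) := by
    have hc : Continuous fun t : ℝ => b + (t : ℂ) * u := by fun_prop
    simpa using hc.tendsto 0
  have h_in2 : Tendsto (fun t : ℝ => a + (b + (t : ℂ) * u) - p) (𝓝 0) (𝓝 (a + b - p)) := by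
    have hc : Continuous fun t : ℝ => a + (b + (t : ℂ) * u) - p := by fun_prop
    simpa using hc.tendsto 0
  have h_ev : ∀ᶠ t : ℝ in 𝓝[≠] (0 : ℝ),
      f (a + (b + (t : ℂ) * u) - p) - p = (f a - p) + (f (b + (t : ℂ) * u) - p) := by
    have h1 : ∀ᶠ t : ℝ in 𝓝[≠] (0 : ℝ), t ∈ ({0}ᶜ : Set ℝ) := eventually_mem_nhdsWithin
    have h2 : ∀ᶠ t : ℝ in 𝓝 (0 : ℝ), ‖b + (t : ℂ) * u - p‖ < r' :=
      ((h_in.sub tendsto_const_nhds).norm).eventually_lt_const hb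
    have h3 : ∀ᶠ t : ℝ in 𝓝 (0 : ℝ), ‖a + (b + (t : ℂ) * u) - p - p‖ < r' :=
      ((h_in2.sub tendsto_const_nhds).norm).eventually_lt_const hab
    filter_upwards [h1, h2.filter_mono nhdsWithin_le_nhds, h3.filter_mono nhdsWithin_le_nhds]
      with t ht h2 h3
    have hind_t : LinearIndependent ℝ ![a - p, b + (t : ℂ) * u - p] := by
      rw [show b + (t : ℂ) * u - p = (b - p) + (t : ℂ) * (I * x) by rw [hu]; ring]
      exact linearIndependent_pair_perturb hx0 hind ht
    exact hgen a (b + (t : ℂ) * u) ha h2 h3 hind_t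
  have hca : ContinuousAt f (a + b - p) :=
    hfc.continuousAt (Metric.isOpen_ball.mem_nhds (hballr (hr_of hab)))
  have hcb : ContinuousAt f b := hfc.continuousAt (Metric.isOpen_ball.mem_nhds (hballr (hr_of hb)))
  have hlim1 : Tendsto (fun t : ℝ => f (a + (b + (t : ℂ) * u) - p) - p) (𝓝[≠] (0 : ℝ))
      (𝓝 (f (a + b - p) - p)) :=
    ((hca.tendsto.comp h_in2).sub tendsto_const_nhds).mono_left nhdsWithin_le_nhds
  have hlim2 : Tendsto (fun t : ℝ => (f a - p) + (f (b + (t : ℂ) * u) - p)) (𝓝[≠] (0 : ℝ))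
      (𝓝 ((f a - p) + (f b - p))) :=
    (tendsto_const_nhds.add ((hcb.tendsto.comp h_in).sub tendsto_const_nhds)).mono_left
      nhdsWithin_le_nhds
  exact tendsto_nhds_unique_of_eventuallyEq hlim1 hlim2 h_ev

end Compat

end

end Literature.AnabelianGeometry.AbsoluteAnabelian
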